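import Summits.AtomisticToContinuum.Crystallization.Theorems.ThreeConeCertificateExactCertificateNoGapIff

/-!
# `ExactCertificate` (stmt-AtomisticToContinuum-11959): `SharpSplit` is a statement about PERIODIC
# configurations only

Line `closure-makes-nogap-exact`, continuation lead c2 (registered stub `stub_sharpSplitPeriodic`).

The crux factors as `ExactCertificate ↔ SharpSplit ∧ PeriodicMinimum` (`NoGap.stub_iff`,
`exactCertificate_iff_sharpSplit_and_periodicMinimum`), where
`SharpSplit := ∃ ρ c g U f, IsSplit ρ c g U f ∧ c + f 0/2 = −e*` still quantifies over all FINITE injective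
configurations through the stability clause (S5).  This file removes them:

**Theorem (`stub_sharpSplitPeriodic`).**
`SharpSplit ↔ ∃ ρ f, f radially of positive type ∧ f ≤ V_LJ on [ρ,∞) ∩ (0,∞) ∧
  ∀ Q periodic, e* + f 0/2 ≤ e_Q((V_LJ − f)·1_{(0,ρ)})`,
i.e. the designed finite-range potential `g_f = (V_LJ − f)1_{(0,ρ)}` has PERIODIC ground-state energy
`e* + f 0/2` (it is `≤` for every admissible `(ρ, f)`, `periodicInf_core_le`).  Equivalently, by lattice-sum
accounting (`sharpSplit_iff_tailSlack_le`): for every periodic `Q` the tail-slack functional of `stub_noGap`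
satisfies `f 0 + 2e_Q(f·1_{(0,ρ)}) + 2e_Q(V_LJ·1_{[ρ,∞)}) ≤ 2(e_Q(V_LJ) − e*)`.

* `→`: a split is `c`-stable on the core, so core weak duality on `Q`-blocks
  (`Slackness.const_le_energyPerParticle_of_stable`) gives `−c ≤ e_Q(g_f)`, and `−c = e* + f 0/2`.
* `←` (`stable_of_periodic_bound`): PERIODISATION — a finite injective `x` repeated with the cubic period
  `L = 2Σ‖xᵢ‖ + 2 + |ρ|` is a periodic configuration `Q_x` whose other points are at distance `≥ 2 + |ρ| ≥ ρ`
  from the `xᵢ` (`ChargedEnergyGapNegative.sub_le_dist_of_mem_points`), so the finite-range `g_f` does not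
  see the copies and `e_{Q_x}(g_f) ≤ E_{g_f}(x)/N` (`energyPerParticle_periodise_le_of_finRange`); hence
  `N(e* + f 0/2) ≤ N·e_{Q_x}(g_f) ≤ E_{g_f}(x)`, which is (S5) for the normal-form split with
  `c := −(e* + f 0/2)`, and its value is `−e*` on the nose.

So the open half of the crux reads: "there is a positive-type correction `f`, dominated by `V_LJ` beyond a
finite range, whose truncated corrected potential does not lower the periodic infimum below `e* + f 0/2`" —
finite-range PERIODIC crystallisation for a designed potential.  All `[folklore]`.
-/

noncomputable section

namespace Summit.AtomisticToContinuum.Crystallization.Theorems.ThreeConeCertificateExactCertificate.NoGap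

open Literature.MathematicalPhysics.StatisticalMechanics
open Summit.AtomisticToContinuum.Crystallization.Theorems.ChargedEnergyGapNegative
  (E3 eStar eStar_le Dsum Dsum_nonneg period period_pos periodise motif_periodise
    sub_le_dist_of_mem_points)
open Summit.AtomisticToContinuum.Crystallization.Theorems.ExactCertificateNegative (IsSplit)
open Summit.AtomisticToContinuum.Crystallization.Theorems.ThreeConeCertificateExactCertificate.Slackness
  (stable_core const_le_energyPerParticle_of_stable summable_of_finRange energyPerParticle_split_range)
open scoped BigOperators

/-! ## Periodisation does not raise the energy per particle of a finite-range potential -/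

/-- For a potential `W` vanishing on `[ρ,∞)` and a period `c ≥ 2Σ‖xᵢ‖ + 2` with `c − 2Σ‖xᵢ‖ ≥ ρ`, the lattice
sum of `W` at `xᵢ` over the periodisation of `x` equals the finite site energy `Σ_{k ≠ i} W(|xᵢ − x_k|)`: the
periodic images are out of range.  Stated as `≤` (all that is used). [folklore] -/
theorem tsum_le_siteEnergy_of_finRange {N : ℕ} {x : Fin N → E3} (hx : Function.Injective x) {W : ℝ → ℝ}
    {ρ : ℝ} (hW : ∀ r, ρ ≤ r → W r = 0) (c : ℝˣ) (hc : period x ≤ (c : ℝ))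
    (hcρ : ρ ≤ (c : ℝ) - 2 * Dsum x) (hN : 0 < N) (i : Fin N) :
    (∑' y : {y : E3 // y ∈ (periodise x c hc hN).points ∧ y ≠ x i}, W (dist (x i) y.1)) ≤
      siteEnergy W x i := by
  set P := periodise x c hc hN with hP
  set F : {y : E3 // y ∈ P.points ∧ y ≠ x i} → ℝ := fun y => W (dist (x i) y.1) with hF
  have hsum : Summable F := summable_of_finRange P hW (x i)
  have hmem : ∀ k : {k // k ∈ Finset.univ.erase i}, x k.1 ∈ P.points ∧ x k.1 ≠ x i := fun k =>
    ⟨P.mem_points_of_mem_motif (by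
        rw [hP, motif_periodise]; exact Finset.mem_image_of_mem x (Finset.mem_univ _)),
      hx.ne (Finset.ne_of_mem_erase k.2)⟩
  set emb : {k // k ∈ Finset.univ.erase i} → {y : E3 // y ∈ P.points ∧ y ≠ x i} :=
    fun k => ⟨x k.1, hmem k⟩ with hemb
  have hinj : Function.Injective emb := by
    intro k l hkl
    have h1 : x k.1 = x l.1 := congrArg Subtype.val hkl
    exact Subtype.ext (hx h1)
  set s₀ : Finset {y : E3 // y ∈ P.points ∧ y ≠ x i} := (Finset.univ.erase i).attach.image emb
    with hs₀
  have hsign : ∀ y ∉ s₀, 0 ≤ (fun b => -F b) y := by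
    intro y hy
    have hfar : ∀ j, y.1 ≠ x j := by
      intro j hj
      by_cases hji : j = i
      · exact y.2.2 (hji ▸ hj)
      · exact hy (Finset.mem_image.2 ⟨⟨j, Finset.mem_erase.2 ⟨hji, Finset.mem_univ j⟩⟩,
          Finset.mem_attach _ _, Subtype.ext hj.symm⟩)
    have h1 := sub_le_dist_of_mem_points x c hc hN i y.2.1 hfar
    simp only [hF, neg_nonneg]
    exact (hW _ (hcρ.trans h1)).le
  have h1 := sum_le_hasSum s₀ hsign hsum.hasSum.neg
  have h2 : ∑ y ∈ s₀, F y = siteEnergy W x i := by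
    rw [hs₀, Finset.sum_image fun k _ l _ h => hinj h]
    exact Finset.sum_attach (Finset.univ.erase i) fun k => W (dist (x i) (x k))
  rw [Finset.sum_neg_distrib, h2] at h1
  linarith

/-- Hence **`e_W(periodisation of x) ≤ E_W(x)/N`** for a finite-range `W` and such a period. [folklore] -/
theorem energyPerParticle_periodise_le_of_finRange {N : ℕ} {x : Fin N → E3} (hx : Function.Injective x)
    {W : ℝ → ℝ} {ρ : ℝ} (hW : ∀ r, ρ ≤ r → W r = 0) (c : ℝˣ) (hc : period x ≤ (c : ℝ))
    (hcρ : ρ ≤ (c : ℝ) - 2 * Dsum x) (hN : 0 < N) :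
    (periodise x c hc hN).energyPerParticle W ≤ interactionEnergy W x / N := by
  have hcard : (periodise x c hc hN).motif.card = N := by
    rw [motif_periodise, Finset.card_image_of_injective _ hx, Finset.card_univ, Fintype.card_fin]
  have hNr : (0 : ℝ) < N := by exact_mod_cast hN
  unfold PeriodicConfiguration.energyPerParticle
  rw [hcard]
  have hsum : ∑ z ∈ (periodise x c hc hN).motif,
      ∑' y : {y : E3 // y ∈ (periodise x c hc hN).points ∧ y ≠ z}, W (dist z y.1) ≤
        ∑ i, siteEnergy W x i := by
    rw [motif_periodise, Finset.sum_image fun i _ j _ h => hx h]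
    exact Finset.sum_le_sum fun i _ => tsum_le_siteEnergy_of_finRange hx hW c hc hcρ hN i
  rw [← two_mul_interactionEnergy] at hsum
  calc (2 * (N : ℝ))⁻¹ * ∑ z ∈ (periodise x c hc hN).motif,
        ∑' y : {y : E3 // y ∈ (periodise x c hc hN).points ∧ y ≠ z}, W (dist z y.1)
      ≤ (2 * (N : ℝ))⁻¹ * (2 * interactionEnergy W x) :=
        mul_le_mul_of_nonneg_left hsum (by positivity)
    _ = interactionEnergy W x / N := by
        field_simp

/-- **A periodic lower bound for a finite-range potential is a stability constant**: if `κ ≤ e_Q(W)` for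
every periodic `Q` and `W` vanishes on `[ρ,∞)`, then `κ·N ≤ E_W(x)` for every injective `x`
(periodise `x` with the period `2Σ‖xᵢ‖ + 2 + |ρ|`).  Converse of
`Slackness.const_le_energyPerParticle_of_stable`: for finite-range potentials the best stability constant IS
minus the periodic infimum. [folklore] -/
theorem stable_of_periodic_bound {W : ℝ → ℝ} {ρ κ : ℝ} (hW : ∀ r, ρ ≤ r → W r = 0)
    (hQ : ∀ Q : PeriodicConfiguration 3, κ ≤ Q.energyPerParticle W) {N : ℕ} {x : Fin N → E3}
    (hx : Function.Injective x) : κ * N ≤ interactionEnergy W x := by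
  rcases Nat.eq_zero_or_pos N with rfl | hN
  · simp [interactionEnergy]
  · have hL : 0 < period x + |ρ| := by linarith [period_pos x, abs_nonneg ρ]
    set c : ℝˣ := Units.mk0 (period x + |ρ|) hL.ne' with hcdef
    have hcv : (c : ℝ) = period x + |ρ| := rfl
    have hc : period x ≤ (c : ℝ) := by rw [hcv]; linarith [abs_nonneg ρ]
    have hcρ : ρ ≤ (c : ℝ) - 2 * Dsum x := by
      rw [hcv]; unfold period; linarith [le_abs_self ρ]
    have h1 := hQ (periodise x c hc hN)
    have h2 := energyPerParticle_periodise_le_of_finRange hx hW c hc hcρ hN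
    have hNr : (0 : ℝ) < N := by exact_mod_cast hN
    have := h1.trans h2
    rwa [le_div_iff₀ hNr] at this

/-! ## The registered stub -/

/-- **Registered stub `stub_sharpSplitPeriodic` of crux item stmt-AtomisticToContinuum-11959 (line
`closure-makes-nogap-exact`; signature verbatim): `SharpSplit` IS A STATEMENT ABOUT PERIODIC CONFIGURATIONS
ONLY** — some finite-range three-cone split of `V_LJ` attains the floor `−e*` iff there are a range `ρ` and a
radial positive-type `f` with `f ≤ V_LJ` on `[ρ,∞) ∩ (0,∞)` such that every periodic `Q` has
`e* + f 0/2 ≤ e_Q((V_LJ − f)1_{(0,ρ)})`. [folklore] -/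
theorem stub_sharpSplitPeriodic :
    (∃ (ρ c : ℝ) (g U f : ℝ → ℝ),
      Summit.AtomisticToContinuum.Crystallization.Theorems.ExactCertificateNegative.IsSplit ρ c g U f ∧
        c + f 0 / 2 = -Summit.AtomisticToContinuum.Crystallization.Theorems.ChargedEnergyGapNegative.eStar) ↔
    ∃ (ρ : ℝ) (f : ℝ → ℝ),
      (∀ (n : ℕ) (y : Fin n → EuclideanSpace ℝ (Fin 3)) (w : Fin n → ℝ),
        0 ≤ ∑ i, ∑ j, w i * w j * f (dist (y i) (y j))) ∧
      (∀ r : ℝ, ρ ≤ r → 0 < r → f r ≤ lennardJones r) ∧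
      ∀ Q : PeriodicConfiguration 3,
        Summit.AtomisticToContinuum.Crystallization.Theorems.ChargedEnergyGapNegative.eStar + f 0 / 2 ≤
          Q.energyPerParticle (fun r => if r < ρ then lennardJones r - f r else 0) := by
  constructor
  · rintro ⟨ρ, c, g, U, f, hs, hv⟩
    refine ⟨ρ, f, hs.posType, fun r hρ hr => hs.f_le_tail hρ hr, fun Q => ?_⟩
    have hst : ∀ (N : ℕ) (x : Fin N → E3), Function.Injective x →
        (-c) * N ≤ interactionEnergy (fun r => if r < ρ then lennardJones r - f r else 0) x := by
      intro N x hx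
      have := stable_core hs hx
      linarith
    have hcore := const_le_energyPerParticle_of_stable Q
      (W := fun r => if r < ρ then lennardJones r - f r else 0) (ρ := ρ)
      (fun r hr => by
        show (if r < ρ then lennardJones r - f r else 0) = 0
        rw [if_neg (not_lt.2 hr)]) hst
    linarith
  · rintro ⟨ρ, f, hpd, htail, hQ⟩
    refine ⟨ρ, -(eStar + f 0 / 2), fun r => if r < ρ then lennardJones r - f r else 0,
      fun r => if r < ρ then 0 else lennardJones r - f r, f, ⟨?_, ?_, ?_, hpd, ?_⟩, by ring⟩
    · intro r _
      show lennardJones r =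
        (if r < ρ then lennardJones r - f r else 0) + (if r < ρ then 0 else lennardJones r - f r) + f r
      by_cases h : r < ρ
      · rw [if_pos h, if_pos h]; ring
      · rw [if_neg h, if_neg h]; ring
    · intro r hr
      show 0 ≤ (if r < ρ then 0 else lennardJones r - f r)
      by_cases h : r < ρ
      · rw [if_pos h]
      · rw [if_neg h, sub_nonneg]
        exact htail r (not_lt.1 h) hr
    · intro r hr
      show (if r < ρ then lennardJones r - f r else 0) = 0
      rw [if_neg (not_lt.2 hr)]
    · intro N x hx
      have h1 := stable_of_periodic_bound (W := fun r => if r < ρ then lennardJones r - f r else 0) (ρ := ρ)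
        (fun r hr => by
          show (if r < ρ then lennardJones r - f r else 0) = 0
          rw [if_neg (not_lt.2 hr)]) hQ hx
      linarith

/-! ## Consequences -/

/-- **The periodic infimum of the designed core is never above `e* + f 0/2`**: for every range `ρ` and every
radial positive-type `f` below `V_LJ` on the tail, some periodic `Q` has `e_Q((V_LJ − f)1_{(0,ρ)}) < e* + f 0/2 + ε`
(else the normal-form split would beat the floor `IsSplit.value_ge`).  So `stub_sharpSplitPeriodic` asks for
EQUALITY of the periodic ground-state energy of `g_f` with `e* + f 0/2`. [folklore] -/
theorem periodicInf_core_le {ρ : ℝ} {f : ℝ → ℝ}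
    (hpd : ∀ (n : ℕ) (y : Fin n → E3) (w : Fin n → ℝ), 0 ≤ ∑ i, ∑ j, w i * w j * f (dist (y i) (y j)))
    (htail : ∀ r : ℝ, ρ ≤ r → 0 < r → f r ≤ lennardJones r) {ε : ℝ} (hε : 0 < ε) :
    ∃ Q : PeriodicConfiguration 3,
      Q.energyPerParticle (fun r => if r < ρ then lennardJones r - f r else 0) < eStar + f 0 / 2 + ε := by
  by_contra hcon
  push Not at hcon
  -- then `e* + f 0/2 + ε` is a periodic lower bound, hence a stability constant, and the normal-form split
  -- has value `−e* − ε`, below the floor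
  have hst : ∀ (N : ℕ) (x : Fin N → E3), Function.Injective x →
      (eStar + f 0 / 2 + ε) * N ≤ interactionEnergy (fun r => if r < ρ then lennardJones r - f r else 0) x :=
    fun N x hx => stable_of_periodic_bound (W := fun r => if r < ρ then lennardJones r - f r else 0) (ρ := ρ)
      (fun r hr => by
        show (if r < ρ then lennardJones r - f r else 0) = 0
        rw [if_neg (not_lt.2 hr)]) hcon hx
  have hs : IsSplit ρ (-(eStar + f 0 / 2 + ε)) (fun r => if r < ρ then lennardJones r - f r else 0)
      (fun r => if r < ρ then 0 else lennardJones r - f r) f := by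
    refine ⟨?_, ?_, ?_, hpd, ?_⟩
    · intro r _
      show lennardJones r =
        (if r < ρ then lennardJones r - f r else 0) + (if r < ρ then 0 else lennardJones r - f r) + f r
      by_cases h : r < ρ
      · rw [if_pos h, if_pos h]; ring
      · rw [if_neg h, if_neg h]; ring
    · intro r hr
      show 0 ≤ (if r < ρ then 0 else lennardJones r - f r)
      by_cases h : r < ρ
      · rw [if_pos h]
      · rw [if_neg h, sub_nonneg]
        exact htail r (not_lt.1 h) hr
    · intro r hr
      show (if r < ρ then lennardJones r - f r else 0) = 0
      rw [if_neg (not_lt.2 hr)]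
    · intro N x hx
      have := hst N x hx
      linarith
  have := hs.value_ge
  linarith

/-- **`SharpSplit` in tail-slack form**: `SharpSplit ↔ ∃ ρ f` (positive type, `f ≤ V_LJ` on the tail) such that
for EVERY periodic `Q` the tail-slack functional of `stub_noGap` is dominated by twice the excess energy,
`f 0 + 2e_Q(f·1_{(0,ρ)}) + 2e_Q(V_LJ·1_{[ρ,∞)}) ≤ 2(e_Q(V_LJ) − e*)` (lattice-sum accounting
`e_Q(V_LJ) = e_Q(V_LJ1_{<ρ}) + e_Q(V_LJ1_{≥ρ})`, `e_Q((V_LJ−f)1_{<ρ}) = e_Q(V_LJ1_{<ρ}) − e_Q(f1_{<ρ})`). [folklore] -/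
theorem sharpSplit_iff_tailSlack_le :
    (∃ (ρ c : ℝ) (g U f : ℝ → ℝ), IsSplit ρ c g U f ∧ c + f 0 / 2 = -eStar) ↔
    ∃ (ρ : ℝ) (f : ℝ → ℝ),
      (∀ (n : ℕ) (y : Fin n → E3) (w : Fin n → ℝ), 0 ≤ ∑ i, ∑ j, w i * w j * f (dist (y i) (y j))) ∧
      (∀ r : ℝ, ρ ≤ r → 0 < r → f r ≤ lennardJones r) ∧
      ∀ Q : PeriodicConfiguration 3,
        f 0 + 2 * Q.energyPerParticle (fun r => if r < ρ then f r else 0) +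
            2 * Q.energyPerParticle (fun r => if r < ρ then 0 else lennardJones r) ≤
          2 * (Q.energyPerParticle lennardJones - eStar) := by
  rw [stub_sharpSplitPeriodic]
  refine exists_congr fun ρ => exists_congr fun f => and_congr_right fun _ => and_congr_right fun _ =>
    forall_congr' fun Q => ?_
  have hV := energyPerParticle_split_range Q ρ
  have hg := energyPerParticle_core_sub Q ρ f
  constructor <;> intro h <;> linarith

end Summit.AtomisticToContinuum.Crystallization.Theorems.ThreeConeCertificateExactCertificate.NoGap

end
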